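import Mathlib

/-!
# Sketch — crux idea `contact-asymmetry-information`
(crux `LocalSecondLaw`, stmt-AtomisticToContinuum-13081; crux-ideate round 2, ideator 5)

First lemma of the line: the EXACT information identity behind the one-particle entropy production,
at the level of an abstract measure space `(X, μ)` with a `μ`-preserving measurable involution `J`.
APPLICATION (primary, ensemble/BBGKY level): `X = I := {(n̂, v, w) ∈ 𝕊² × V3 × V3 | incoming}` with
`dn̂ dv dw` restricted to `I`, `J = R : (n̂, v, w) ↦ (−n̂, v′, w′)` (time-reversed post-collisional pair
read as an incoming pair; `R` maps `I` to `I`, preserves the measure — tree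
`measurePreserving_swap_negDir`, `measurePreserving_collideSwap_prod` — and is involutive), `q` = the
flux-weighted INCOMING contact pair marginal `|g·n̂| f₂(t; x, v; x+εn̂, w)/Z` of the evolved (conditioned)
local Gibbs law at a point `x`, and `b(n̂, v, w) = f₁(t, x, v) · f₁(t, x+εn̂, w)` the two-point product of
one-particle marginals; then `E_q[log b − log b∘R]` is, up to the Résibois offset term and a divergence,
the collision term of the exact first-BBGKY entropy balance.  APPLICATION (diagnostic, quenched): `q` =
density of the `(r, ϑ)`-booked Gaussian-smoothed empirical incoming pair law at an analysis point `x₀`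
and `b = hm ⊗ hm` (crux 13078's let-tower) — the MD/DSMC-measurable version.

* `bookedProduction μ J q b = ∫ q · (log b − log (b ∘ J))` — the booked surprisal production `E_Q[F_b]`;
* `asymmetryInfo μ J q = ∫ (q ∘ J) · (log (q ∘ J) − log q) = KL(QJ ‖ Q) ≥ 0` — the J-ASYMMETRY
  INFORMATION of the contact law (how distinguishable outgoing pair statistics are from incoming ones);
* `oddLogCorrelation μ J q b = ∫ (q ∘ J − q) · log (q / b)` — the `Q`-mean of (minus twice) the
  J-ODD part of the log booked-pair-correlation `log (q / b)`.

Identity: `bookedProduction = asymmetryInfo + oddLogCorrelation` (proved below, sorry-free), and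
`0 ≤ asymmetryInfo` (Gibbs inequality + mass conservation `∫ q ∘ J = ∫ q`).  Both right-hand terms
vanish identically when `q ∘ J = q` — the fixed-`r` mixture rock of TRIAGE r1-1..3 cannot touch them.
Corollary `bookedProduction_ge_of_relative_bound`: the one-sided RELATIVE hypothesis
`oddLogCorrelation ≥ −c · asymmetryInfo − η` with `c ≤ 1` gives `bookedProduction ≥ −η` — the typed
shape of crux input K1 of the card.
-/

open MeasureTheory Function

namespace Summit.AtomisticToContinuum.HydrodynamicLimit.Cruxes.LocalSecondLaw.ContactAsymmetry

variable {X : Type*} [MeasurableSpace X]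

/-- Booked surprisal production of the reference density `b` under the pair law of density `q`:
`E_Q[log b − log (b ∘ J)]`. -/
noncomputable def bookedProduction (μ : Measure X) (J : X → X) (q b : X → ℝ) : ℝ :=
  ∫ x, q x * (Real.log (b x) - Real.log (b (J x))) ∂μ

/-- J-asymmetry information `KL(QJ ‖ Q) = ∫ (q ∘ J) (log (q ∘ J) − log q)`. -/
noncomputable def asymmetryInfo (μ : Measure X) (J : X → X) (q : X → ℝ) : ℝ :=
  ∫ x, q (J x) * (Real.log (q (J x)) - Real.log (q x)) ∂μ

/-- Odd log-correlation term `∫ (q ∘ J − q) (log q − log b)`. -/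
noncomputable def oddLogCorrelation (μ : Measure X) (J : X → X) (q b : X → ℝ) : ℝ :=
  ∫ x, (q (J x) - q x) * (Real.log (q x) - Real.log (b x)) ∂μ

section Identity

variable {μ : Measure X} {J : X → X} {q b : X → ℝ}

/-- **The booked production is J-asymmetry information plus the odd log-correlation term** — an
exact identity (change of variables under the `μ`-preserving involution `J`; no positivity needed). -/
theorem bookedProduction_eq_asymmetryInfo_add_oddLogCorrelation
    (hJ : MeasurePreserving J μ μ) (hJJ : Involutive J)
    (h1 : Integrable (fun x => q x * Real.log (q x)) μ)
    (h2 : Integrable (fun x => q x * Real.log (b x)) μ)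
    (h3 : Integrable (fun x => q (J x) * Real.log (q x)) μ)
    (h4 : Integrable (fun x => q (J x) * Real.log (b x)) μ) :
    bookedProduction μ J q b = asymmetryInfo μ J q + oddLogCorrelation μ J q b := by
  have hJ2 : ∀ x, J (J x) = x := hJJ
  have hemb : MeasurableEmbedding J :=
    (MeasurableEquiv.ofInvolutive J hJJ hJ.measurable).measurableEmbedding
  -- transport of integrals along `J`
  have T1 : ∫ x, q (J x) * Real.log (q (J x)) ∂μ = ∫ x, q x * Real.log (q x) ∂μ :=
    hJ.integral_comp hemb (fun x => q x * Real.log (q x))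
  have T2 : ∫ x, q x * Real.log (b (J x)) ∂μ = ∫ x, q (J x) * Real.log (b x) ∂μ := by
    have h := hJ.integral_comp hemb (fun x => q (J x) * Real.log (b x))
    simp only [hJ2] at h
    exact h
  -- integrability of the transported pieces
  have i1 : Integrable (fun x => q (J x) * Real.log (q (J x))) μ :=
    (hJ.integrable_comp_emb hemb (g := fun x => q x * Real.log (q x))).2 h1
  have i5 : Integrable (fun x => q x * Real.log (b (J x))) μ := by
    have h := (hJ.integrable_comp_emb hemb (g := fun x => q (J x) * Real.log (b x))).2 h4
    refine h.congr (Filter.Eventually.of_forall fun x => ?_)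
    simp [Function.comp, hJ2]
  -- expand the three functionals
  have eP : bookedProduction μ J q b
      = (∫ x, q x * Real.log (b x) ∂μ) - ∫ x, q x * Real.log (b (J x)) ∂μ := by
    unfold bookedProduction
    rw [← integral_sub h2 i5]
    congr 1; ext x; ring
  have eA : asymmetryInfo μ J q
      = (∫ x, q (J x) * Real.log (q (J x)) ∂μ) - ∫ x, q (J x) * Real.log (q x) ∂μ := by
    unfold asymmetryInfo
    rw [← integral_sub i1 h3]
    congr 1; ext x; ring
  have i34 : Integrable (fun x => q (J x) * Real.log (q x) - q (J x) * Real.log (b x)) μ :=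
    h3.sub h4
  have i12 : Integrable (fun x => q x * Real.log (q x) - q x * Real.log (b x)) μ := h1.sub h2
  have eX : oddLogCorrelation μ J q b
      = ((∫ x, q (J x) * Real.log (q x) ∂μ) - ∫ x, q (J x) * Real.log (b x) ∂μ)
        - ((∫ x, q x * Real.log (q x) ∂μ) - ∫ x, q x * Real.log (b x) ∂μ) := by
    unfold oddLogCorrelation
    have e1 : (fun x => (q (J x) - q x) * (Real.log (q x) - Real.log (b x)))
        = fun x => (q (J x) * Real.log (q x) - q (J x) * Real.log (b x))
            - (q x * Real.log (q x) - q x * Real.log (b x)) := by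
      ext x; ring
    rw [e1, integral_sub i34 i12, integral_sub h3 h4, integral_sub h1 h2]
  rw [eP, eA, eX, T1, T2]
  ring

/-- **Gibbs inequality for the J-asymmetry information**: `0 ≤ KL(QJ ‖ Q)`, using only positivity of
`q`, mass conservation `∫ q ∘ J = ∫ q` (measure preservation) and `log y ≤ y − 1`. -/
theorem asymmetryInfo_nonneg
    (hJ : MeasurePreserving J μ μ) (hJJ : Involutive J)
    (hq : ∀ x, 0 < q x) (hqi : Integrable q μ)
    (h1 : Integrable (fun x => q x * Real.log (q x)) μ)
    (h3 : Integrable (fun x => q (J x) * Real.log (q x)) μ) :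
    0 ≤ asymmetryInfo μ J q := by
  have hemb : MeasurableEmbedding J :=
    (MeasurableEquiv.ofInvolutive J hJJ hJ.measurable).measurableEmbedding
  have T0 : ∫ x, q (J x) ∂μ = ∫ x, q x ∂μ := hJ.integral_comp hemb q
  have iqJ : Integrable (fun x => q (J x)) μ := (hJ.integrable_comp_emb hemb (g := q)).2 hqi
  have i1 : Integrable (fun x => q (J x) * Real.log (q (J x))) μ :=
    (hJ.integrable_comp_emb hemb (g := fun x => q x * Real.log (q x))).2 h1
  have key : ∀ x, q (J x) - q x ≤ q (J x) * (Real.log (q (J x)) - Real.log (q x)) := by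
    intro x
    have hp : 0 < q (J x) := hq (J x)
    have hx : 0 < q x := hq x
    have hlog : Real.log (q x / q (J x)) ≤ q x / q (J x) - 1 :=
      Real.log_le_sub_one_of_pos (div_pos hx hp)
    rw [Real.log_div hx.ne' hp.ne'] at hlog
    have hmul := mul_le_mul_of_nonneg_left hlog hp.le
    have hcalc : q (J x) * (q x / q (J x) - 1) = q x - q (J x) := by
      field_simp
    rw [hcalc] at hmul
    linarith
  have hint : Integrable (fun x => q (J x) * (Real.log (q (J x)) - Real.log (q x))) μ := by
    refine (i1.sub h3).congr (Filter.Eventually.of_forall fun x => ?_)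
    simp only [Pi.sub_apply]; ring
  calc (0 : ℝ) = (∫ x, q (J x) ∂μ) - ∫ x, q x ∂μ := by rw [T0]; ring
    _ = ∫ x, (q (J x) - q x) ∂μ := (integral_sub iqJ hqi).symm
    _ ≤ ∫ x, q (J x) * (Real.log (q (J x)) - Real.log (q x)) ∂μ :=
        integral_mono (iqJ.sub hqi) hint key
    _ = asymmetryInfo μ J q := rfl

/-- **Sign stability** (the typed shape of the card's crux input K1): a one-sided RELATIVE bound of the
odd log-correlation term by the asymmetry information, with constant `c ≤ 1` and slack `η`, forces the
booked production to be `≥ −η`. -/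
theorem bookedProduction_ge_of_relative_bound
    (hJ : MeasurePreserving J μ μ) (hJJ : Involutive J)
    (hq : ∀ x, 0 < q x) (hqi : Integrable q μ)
    (h1 : Integrable (fun x => q x * Real.log (q x)) μ)
    (h2 : Integrable (fun x => q x * Real.log (b x)) μ)
    (h3 : Integrable (fun x => q (J x) * Real.log (q x)) μ)
    (h4 : Integrable (fun x => q (J x) * Real.log (b x)) μ)
    {c η : ℝ} (hc : c ≤ 1)
    (hK1 : -c * asymmetryInfo μ J q - η ≤ oddLogCorrelation μ J q b) :
    -η ≤ bookedProduction μ J q b := by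
  have hA := asymmetryInfo_nonneg hJ hJJ hq hqi h1 h3
  rw [bookedProduction_eq_asymmetryInfo_add_oddLogCorrelation hJ hJJ h1 h2 h3 h4]
  nlinarith

/-- **Budget** (same hypotheses): the asymmetry information is controlled by the booked production,
`(1 − c) · KL(QJ ‖ Q) ≤ bookedProduction + η` — the free Maxwellisation budget of the card (the booked
production is bounded above by the kinetic-entropy drop, an a-priori quantity). -/
theorem asymmetryInfo_le_of_relative_bound
    (hJ : MeasurePreserving J μ μ) (hJJ : Involutive J)
    (h1 : Integrable (fun x => q x * Real.log (q x)) μ)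
    (h2 : Integrable (fun x => q x * Real.log (b x)) μ)
    (h3 : Integrable (fun x => q (J x) * Real.log (q x)) μ)
    (h4 : Integrable (fun x => q (J x) * Real.log (b x)) μ)
    {c η : ℝ}
    (hK1 : -c * asymmetryInfo μ J q - η ≤ oddLogCorrelation μ J q b) :
    (1 - c) * asymmetryInfo μ J q ≤ bookedProduction μ J q b + η := by
  rw [bookedProduction_eq_asymmetryInfo_add_oddLogCorrelation hJ hJJ h1 h2 h3 h4]
  nlinarith

end Identity

end Summit.AtomisticToContinuum.HydrodynamicLimit.Cruxes.LocalSecondLaw.ContactAsymmetry
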